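import Summits.Schanuel.Schanuel.Theorems.RootDecomp1KLogLogCell06

/-!
# RootDecomp1KLogLogCell — lens 1, generation 35 «LOG-LOG CELL of 33364» (RootDecomp1KLogLogCell.lean 05ce2a21…, 1940 l) — continuation (RootDecomp1KLogLogCell07): §7 the shared-digit certificate for `(1, ℓ₂, ρ_E)` (`eInd`, `rhoE_eq_tsum_eInd`, `formE_eq_digitSum`, `exists_digit_ne_zero_E`, `formE_lower_bound`)

(lens-1 g35 `RootDecomp1KLogLogCell.lean`, sha256 05ce2a21…c847, own farm rc 0 · 0 sorry · axioms std; critic VERDICT STATUS L1698 PORT GO LOW;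
port by census-1 gen 15 in eight parts `RootDecomp1KLogLogCell01`–`08` — see the PORT NOTE of part 01; `--supports stmt-Schanuel-33364`; rung 0.)
-/

noncomputable section

open Complex IntermediateField Polynomial
open Summit.Schanuel.Schanuel.Theorems.RootDecomp1KHyper
open Summit.Schanuel.Schanuel.Theorems.RootDecomp1KHyper.HyperCell
open Summit.Schanuel.Schanuel.Theorems.RootDecomp1KGeneric
open Summit.Schanuel.Schanuel.Theorems.RootDecomp1KRelLiouvilleCell

namespace Summit.Schanuel.Schanuel.Theorems.RootDecomp1KLogLogCell

/-! ## §7  The shared-digit certificate: no hyper-small integer linear form in `(1, ℓ₂, ρ_E)`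

`ℓ₂ = Σ_k 2^{-k!}` and `ρ_E = Σ_k 1_{2ℕ}(k) 2^{-k!}` share the digit skeleton `{2^{-k!}}`; an integer form
`h₀ + h₁ℓ₂ + h₂ρ_E = h₀ + Σ_k u_k 2^{-k!}` has digits `u_k = h₁ + h₂ 1_{2ℕ}(k)`, `|u_k| ≤ S = |h₁| + |h₂|`, and a
NON-ZERO digit at one of the two positions `N+1, N+2` past any scale `N`; the digit lemma (verbatim from g34) then
bounds the form below by `2^{-P!-1} ≥ exp(-(1+S)^{11})`.  (`digitSum`, `digit_lower_bound`, `tower_budget`,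
`factorial_pos_le_pow` are g34's, imported from the tree port `…RelLiouvilleCell06/07`; the two private summability
lemmas are re-proved here.) -/

section Digits
open LiouvilleNumber
open scoped Nat

/-- The series `Σ_k 2^{-k!}` is summable. -/
private theorem summable_one_div_two_pow_factorial : Summable fun k : ℕ => 1 / (2 : ℝ) ^ k ! :=
  summable_one_div_pow_of_le one_lt_two fun k => Nat.self_le_factorial k

/-- A digit series `Σ_k u_k / 2^{k!}` with bounded integer digits is summable. -/
private theorem summable_digit {u : ℕ → ℤ} {S : ℤ} (hS : ∀ k, |u k| ≤ S) :
    Summable fun k => (u k : ℝ) / (2 : ℝ) ^ k ! := by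
  refine Summable.of_norm_bounded (summable_one_div_two_pow_factorial.mul_left (S : ℝ)) fun k => ?_
  have h2 : (0 : ℝ) < 2 ^ k ! := by positivity
  rw [Real.norm_eq_abs, abs_div, abs_of_pos h2, div_eq_mul_one_div]
  exact mul_le_mul_of_nonneg_right (by exact_mod_cast hS k) (one_div_nonneg.mpr h2.le)

/-- The digit indicator of the EVEN positions (`ρ_E`'s support on the skeleton). -/
def eInd (k : ℕ) : ℤ := if Even k then 1 else 0

/-- The even indicator is `1` at even `k`. -/
theorem eInd_of_even {k : ℕ} (hk : Even k) : eInd k = 1 := if_pos hk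

/-- The even indicator is `0` at odd `k`. -/
theorem eInd_of_not_even {k : ℕ} (hk : ¬ Even k) : eInd k = 0 := if_neg hk

/-- `eInd (2j) = 1`. -/
theorem eInd_two_mul (j : ℕ) : eInd (2 * j) = 1 := eInd_of_even (even_two_mul j)

/-- `|eInd k| ≤ 1`. -/
theorem abs_eInd_le (k : ℕ) : |eInd k| ≤ 1 := by
  unfold eInd; split_ifs <;> simp

/-- `ρ_E` as a digit series on the skeleton `{2^{-k!}}`. -/
theorem rhoE_eq_tsum_eInd : rhoE = ∑' k, (eInd k : ℝ) / (2 : ℝ) ^ k ! := by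
  have hinj : Function.Injective fun j : ℕ => 2 * j := fun a b h => by simpa using h
  have hsupp : Function.support (fun k => (eInd k : ℝ) / (2 : ℝ) ^ k !) ⊆ Set.range fun j : ℕ => 2 * j := by
    intro k hk
    by_contra hk'
    have hne : ¬ Even k := fun ⟨j, hj⟩ => hk' ⟨j, by show 2 * j = k; omega⟩
    exact hk (by simp [eInd_of_not_even hne])
  rw [rhoE, ← hinj.tsum_eq hsupp]
  exact tsum_congr fun j => by simp [eInd_two_mul]

/-- The integer linear form `h₀ + h₁ℓ₂ + h₂ρ_E` is `h₀ + D(u)` with digits `u_k = h₁ + h₂·1_{2ℕ}(k)`. -/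
theorem formE_eq_digitSum (h₀ h₁ h₂ : ℤ) :
    (h₀ : ℝ) + h₁ * liouvilleNumber 2 + h₂ * rhoE = h₀ + digitSum fun k => h₁ + h₂ * eInd k := by
  have hs1 := summable_one_div_two_pow_factorial
  have hs2 : Summable fun k : ℕ => (eInd k : ℝ) / (2 : ℝ) ^ k ! := summable_digit abs_eInd_le
  rw [add_assoc, digitSum, liouvilleNumber, rhoE_eq_tsum_eInd, ← tsum_mul_left, ← tsum_mul_left,
    ← (hs1.mul_left _).tsum_add (hs2.mul_left _)]
  congr 1
  exact tsum_congr fun k => by push_cast; ring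

/-- A non-zero digit of `u_k = h₁ + h₂ 1_{2ℕ}(k)` at position `N + 1` or `N + 2`. -/
theorem exists_digit_ne_zero_E (h₁ h₂ : ℤ) (h12 : h₁ ≠ 0 ∨ h₂ ≠ 0) {N : ℕ} (_hN : 1 ≤ N) :
    ∃ P, N + 1 ≤ P ∧ P ≤ 2 ^ N + 2 ∧ h₁ + h₂ * eInd P ≠ 0 := by
  have hN2 : N < 2 ^ N := Nat.lt_two_pow_self
  have e2 : Even (N + 2) ↔ ¬ Even (N + 1) := Nat.even_add_one
  by_cases hev : Even (N + 1)
  · have hne2 : ¬ Even (N + 2) := fun h => (e2.mp h) hev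
    by_cases e12 : h₁ + h₂ = 0
    · have e1 : h₁ ≠ 0 := by
        intro e1
        rcases h12 with h | h
        · exact h e1
        · exact h (by omega)
      exact ⟨N + 2, by omega, by omega, by rw [eInd_of_not_even hne2]; simpa using e1⟩
    · exact ⟨N + 1, le_rfl, by omega, by rw [eInd_of_even hev]; simpa using e12⟩
  · have hev2 : Even (N + 2) := e2.mpr hev
    by_cases e1 : h₁ = 0
    · have e2' : h₂ ≠ 0 := h12.elim (fun h => absurd e1 h) id
      exact ⟨N + 2, by omega, by omega, by rw [eInd_of_even hev2, e1]; simpa using e2'⟩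
    · exact ⟨N + 1, le_rfl, by omega, by rw [eInd_of_not_even hev]; simpa using e1⟩

/-- **THE CERTIFICATE (quantitative).** Every non-zero integer linear form in `(1, ℓ₂, ρ_E)` is bounded
below by `exp(-(1 + |h₀| + |h₁| + |h₂|)^{11})`: the pair `(ℓ₂, ρ_E)` — Liouville to every polynomial
order through `ℓ₂` — admits NO hyper-small forms. -/
theorem formE_lower_bound (h : Fin 3 → ℤ) (hh : h ≠ 0) :
    Real.exp (-((1 + ∑ i, (|h i| : ℝ)) ^ 11)) ≤
      |(h 0 : ℝ) + h 1 * liouvilleNumber 2 + h 2 * rhoE| := by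
  classical
  have hsum3 : ∑ i, (|h i| : ℝ) = |(h 0 : ℝ)| + |(h 1 : ℝ)| + |(h 2 : ℝ)| := by
    simp only [Fin.sum_univ_three]
  set S : ℤ := |h 1| + |h 2| with hSdef
  have ha1 := abs_nonneg (h 1)
  have ha2 := abs_nonneg (h 2)
  have hX1 : (1 : ℝ) + S ≤ 1 + ∑ i, (|h i| : ℝ) := by
    rw [hsum3, hSdef]; push_cast; linarith [abs_nonneg ((h 0 : ℤ) : ℝ)]
  have hXpos : (0 : ℝ) < 1 + ∑ i, (|h i| : ℝ) := by
    have : (0 : ℝ) ≤ S := by exact_mod_cast (show (0 : ℤ) ≤ S by omega)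
    linarith
  by_cases hS : S = 0
  · -- `h₁ = h₂ = 0`, so `h₀ ≠ 0` and the form is the integer `h₀`
    have e1 : h 1 = 0 := abs_eq_zero.mp (by omega)
    have e2 : h 2 = 0 := abs_eq_zero.mp (by omega)
    have e0 : h 0 ≠ 0 := by
      intro e0; apply hh; funext i; fin_cases i <;> simp [e0, e1, e2]
    rw [e1, e2]; push_cast; simp only [zero_mul, add_zero]
    calc Real.exp (-((1 + ∑ i, (|h i| : ℝ)) ^ 11)) ≤ Real.exp 0 :=
          Real.exp_le_exp.mpr (by have := pow_pos hXpos 11; linarith)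
      _ = 1 := Real.exp_zero
      _ ≤ |(h 0 : ℝ)| := by exact_mod_cast Int.one_le_abs e0
  · have h1S : 1 ≤ S := by omega
    -- the first scale `n₀` with `2^{n₀ n₀!} ≥ 8 S`
    have hex : ∃ n, 1 ≤ n ∧ 8 * S ≤ 2 ^ (n * n !) := by
      set N : ℕ := (8 * S).toNat with hNdef
      have eN : (N : ℤ) = 8 * S := Int.toNat_of_nonneg (by omega)
      have hN2 : (N : ℤ) < 2 ^ N := by exact_mod_cast (Nat.lt_two_pow_self : N < 2 ^ N)
      have hNN : (2 : ℤ) ^ N ≤ 2 ^ (N * N !) :=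
        pow_le_pow_right₀ (by norm_num) (Nat.le_mul_of_pos_right N (Nat.factorial_pos N))
      refine ⟨N, ?_, ?_⟩
      · have : (1 : ℤ) ≤ N := by rw [eN]; omega
        exact_mod_cast this
      · rw [eN] at hN2; exact (hN2.trans_le hNN).le
    set n₀ := Nat.find hex with hn₀def
    obtain ⟨hn₀1, hn₀gap⟩ : 1 ≤ n₀ ∧ 8 * S ≤ 2 ^ (n₀ * n₀ !) := Nat.find_spec hex
    have hn₀2 : 2 ≤ n₀ := by
      by_contra hlt
      have e : n₀ = 1 := by omega
      rw [e] at hn₀gap; norm_num [Nat.factorial] at hn₀gap; omega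
    have hmin : ¬ (8 * S ≤ 2 ^ ((n₀ - 1) * (n₀ - 1)!)) := fun hc =>
      Nat.find_min hex (show n₀ - 1 < Nat.find hex by rw [← hn₀def]; omega) ⟨by omega, hc⟩
    -- a non-zero digit at a controlled position
    have h12 : h 1 ≠ 0 ∨ h 2 ≠ 0 := by
      by_cases e1 : h 1 = 0
      · right; intro e2; apply hS; rw [hSdef, e1, e2]; simp
      · exact Or.inl e1
    obtain ⟨P, hP1, hP2, huP⟩ := exists_digit_ne_zero_E (h 1) (h 2) h12 hn₀1
    obtain ⟨n, rfl⟩ : ∃ n, P = n + 1 := ⟨P - 1, by omega⟩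
    have hn1 : 1 ≤ n := by omega
    have hgap : 8 * S ≤ 2 ^ (n * n !) :=
      hn₀gap.trans (pow_le_pow_right₀ (by norm_num)
        (Nat.mul_le_mul (by omega) (Nat.factorial_le (by omega))))
    have hSk : ∀ k, |h 1 + h 2 * eInd k| ≤ S := fun k => by
      calc |h 1 + h 2 * eInd k| ≤ |h 1| + |h 2 * eInd k| := abs_add_le _ _
        _ = |h 1| + |h 2| * |eInd k| := by rw [abs_mul]
        _ ≤ |h 1| + |h 2| * 1 := by gcongr; exact abs_eInd_le k
        _ = S := by rw [hSdef, mul_one]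
    have hlow := digit_lower_bound hSk hn1 hgap huP (h 0)
    rw [← formE_eq_digitSum] at hlow
    -- `exp(-(1+Σ|h|)^11) ≤ exp(-((n+1)!+1)) ≤ 2^{-(n+1)!-1} ≤ |form|`
    have hbud := factorial_pos_le_pow hn₀2 h1S hmin hP2
    have hpow : (((n + 1)! : ℕ) : ℝ) + 1 ≤ (1 + ∑ i, (|h i| : ℝ)) ^ 11 :=
      hbud.trans (pow_le_pow_left₀ (by positivity) hX1 11)
    calc Real.exp (-((1 + ∑ i, (|h i| : ℝ)) ^ 11)) ≤ Real.exp (-((((n + 1)! : ℕ) : ℝ) + 1)) :=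
          Real.exp_le_exp.mpr (neg_le_neg hpow)
      _ ≤ 1 / (2 : ℝ) ^ ((n + 1)! + 1) := by
          rw [Real.exp_neg, ← one_div]
          refine one_div_le_one_div_of_le (by positivity) ?_
          have h2e : (2 : ℝ) ^ ((n + 1)! + 1) ≤ Real.exp 1 ^ ((n + 1)! + 1) :=
            pow_le_pow_left₀ (by norm_num) (by have := Real.exp_one_gt_d9; linarith) _
          rw [Real.exp_one_pow] at h2e
          push_cast at h2e
          exact h2e
      _ ≤ _ := hlow

end Digits

end Summit.Schanuel.Schanuel.Theorems.RootDecomp1KLogLogCell
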